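import Summits.CriticalPhenomena.PercolationContinuityZ3.Theorems.PercNearOneGluingNoHeavyLowerTailSahiMixtureLawThree
import Summits.CriticalPhenomena.PercolationContinuityZ3.Theorems.PercNearOneGluingNoHeavyLowerTailSahiAllOrdersSquarefree

/-!
# The MIXTURE CONJECTURE (law level) is FALSE for four events: ttrl cp-mix's exact counterexample, replayed — and what survives
# (four events ⟺ its eleven square-free rows; the AND-mixture conjecture)

Support file of the one-cut programme (crux `NoHeavyLowerTail`, stmt-CriticalPhenomena-4575; cell `prim-masterthm`, seat P3, gen 5;
`run/shared/lean/prim/prim-masterthm/prim-masterthm-p3/HIERARCHY.md` §12).  REFUTES the typed conjecture `SahiMixture.MixtureBernsteinPositivity` of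
`…SahiMixtureLaw` (this seat, same day) in its OR half at `n = 4`.  The counterexample is ttrl cp-mix's (lane `ttrl/mix`, MIXCOMB.md §7, found by SLSQP on
the cell polynomials of this seat's square-free reduction and rounded to denominator 70; four independent exact recomputations there, a fifth here in the kernel).

* **`allOrders_four_of_rows`** (any probability weight, any four events): the six covariances, the four cubic rows and the quartic row give Sahi positivity at
  EVERY order (`allOrders_iff_squarefree` + symmetry of `E_m`) — `K_4` is cut out by its 11 square-free rows.
* **THE COUNTEREXAMPLE** (`cex4Weight`, `cex4Event`): the pattern law on `2^{[4]}` with masses `w_∅ = 20, w_{0} = 4, w_{012} = 10, w_{3} = 20, w_{013} = 5,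
  w_{023} = 5, w_{123} = 1, w_{0123} = 5` (all `/70`; realised on the 8 atoms of positive mass).  Its 11 rows are `Cov = (113/700, 113/700, 3/2450, 97/700, 1/350,
  1/350)`, `E_3 = (9787/49000, 449/6125, 449/6125, 36/6125)`, `E_4 = 5099/1715000`, all `> 0` (`allOrders_cex4`), yet OR-ing an independent fair coin into the
  members `0, 1` gives `E_4(A_0 ∪ H, A_1 ∪ H, A_2, A_3) = −10301/6860000 < 0` (`sahiE_four_orCoin_cex4`).  Hence **`not_mixtureBernsteinPositivity`**.
  (The theorem for THREE events, `…SahiMixtureLawThree.mixture_three`, stands.  For four events cp-mix decided every square-free cell (MIXCOMB.md §7): exact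
  certificates of degree 5–6 for EVERY AND-cell and for OR-mixing into THREE or FOUR of the members; only OR-mixing into TWO of four fails — smallest symmetric
  violator `(1/20)[w_∅ = 6, w_{012} = 4, w_{3} = 5, w_{013} = w_{023} = w_{123} = 1, w_{0123} = 2]`, `E_4 = −1/250` at `h = ½`.  The violators are not positively
  associated (`Cov(1_{A_0A_1A_2}, 1_{A_3}) < 0`), hence not pattern laws of increasing events of a product measure: the comb-level `SahiCombDisjunct.CombDisjunctiveClosure`
  and OR(∞) are not hit; the measure-free route through `K_n` alone dies exactly at `(n, |F|) = (4, 2)`.)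
* **`AndMixtureBernsteinPositivity`** (`@[conjecture]`): the AND half alone, which survives (THEOREM for `n ≤ 3`: `andMixture_three`; `n = 4`: cp-mix's nine
  degree-5 certificates, Lean replay pending).  OPEN; never import it as a fact.
HONEST FRAMING: a refutation and a re-typing; nothing positive beyond three events is claimed. [this work; counterexample: ttrl cp-mix]
-/

noncomputable section

open scoped Classical

namespace Summit.CriticalPhenomena.PercolationContinuityZ3.Theorems

open Finset Function
open Literature.Combinatorics.Sahi2008
open Literature.Probability.Percolation.BHK2006 (ind_le_one)
open Literature.Probability.Percolation.DecisionTree (ind ind_of_mem ind_of_not_mem ind_nonneg)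

namespace SahiMixture

/-! ### Four events: all orders from the eleven square-free rows -/

section Four

variable {α : Type*} [Fintype α] {μ : α → ℝ} (hμ : ∀ a, 0 ≤ μ a) (hμ1 : ∑ a, μ a = 1) (A : Fin 4 → Set α)
include hμ hμ1

/-- **FOUR EVENTS: all orders from the eleven rows.**  `Cov(A_i,A_j) ≥ 0` (`i < j`), `E_3 ≥ 0` for the four sub-triples (in increasing slot order) and `E_4 ≥ 0`
give `E_m ≥ 0` for every multiset of members. [this work] -/
theorem allOrders_four_of_rows
    (hcov : ∀ i j : Fin 4, i < j → ex μ (ind (A i)) * ex μ (ind (A j)) ≤ ex μ (ind (A i) * ind (A j)))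
    (hE3 : ∀ k : Fin 4, 0 ≤ sahiE μ 3 (fun j => ind (A (k.succAbove j))))
    (hE4 : 0 ≤ sahiE μ 4 (fun j => ind (A j))) : AllOrders μ A := by
  have hcov' : ∀ i j : Fin 4, i ≠ j → ex μ (ind (A i)) * ex μ (ind (A j)) ≤ ex μ (ind (A i) * ind (A j)) := by
    intro i j hij
    rcases lt_or_gt_of_ne hij with h | h
    · exact hcov i j h
    · rw [mul_comm, mul_comm (ind (A i))]; exact hcov j i h
  refine (allOrders_iff_squarefree hμ hμ1 A).2 fun m s hs => ?_
  have hm : m ≤ 4 := by simpa using Fintype.card_le_of_injective s hs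
  interval_cases m
  · rw [sahiE_zero]
  · rw [sahiE_one_apply]; exact ex_nonneg hμ (ind_nonneg _)
  · rw [sahiE_two_apply]
    have h := hcov' (s 0) (s 1) (fun e => by have := hs e; exact absurd this (by decide))
    linarith
  · -- an injective triple misses exactly one member `k`; it is a permutation of `A ∘ k.succAbove`
    obtain ⟨k, -, hk⟩ : ∃ k, k ∈ (univ : Finset (Fin 4)) ∧ k ∉ univ.image s :=
      exists_mem_notMem_of_card_lt_card (by rw [card_image_of_injective _ hs]; simp)
    have hne : ∀ j, s j ≠ k := fun j h => hk (mem_image.2 ⟨j, mem_univ _, h⟩)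
    choose τ hτ using fun j => Fin.exists_succAbove_eq (hne j)
    have hτinj : Injective τ := fun a b hab => hs (by rw [← hτ a, ← hτ b, hab])
    have hτbij : Bijective τ := (Fintype.bijective_iff_injective_and_card τ).2 ⟨hτinj, rfl⟩
    have e : (fun j => ind (A (s j))) = fun j => (fun i => ind (A (k.succAbove i))) (Equiv.ofBijective τ hτbij j) := by
      funext j; simp [hτ j]
    rw [e, sahiE_comp_perm μ 3 (Equiv.ofBijective τ hτbij) (fun i => ind (A (k.succAbove i)))]
    exact hE3 k
  · have hbij : Bijective s := (Fintype.bijective_iff_injective_and_card s).2 ⟨hs, by simp⟩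
    have e : (fun j => ind (A (s j))) = fun j => (fun i => ind (A i)) (Equiv.ofBijective s hbij j) := rfl
    rw [e, sahiE_comp_perm μ 4 (Equiv.ofBijective s hbij) (fun i => ind (A i))]
    exact hE4

end Four

/-- Dispatch over the six increasing pairs of `Fin 4`. [folklore] -/
theorem forall_lt_four {P : Fin 4 → Fin 4 → Prop} (h01 : P 0 1) (h02 : P 0 2) (h03 : P 0 3) (h12 : P 1 2) (h13 : P 1 3) (h23 : P 2 3) :
    ∀ i j : Fin 4, i < j → P i j := by
  intro i j hij
  fin_cases i <;> fin_cases j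
  all_goals first | exact absurd hij (by decide) | exact h01 | exact h02 | exact h03 | exact h12 | exact h13 | exact h23

/-- Dispatch over `Fin 4`. [folklore] -/
theorem forall_four {P : Fin 4 → Prop} (h0 : P 0) (h1 : P 1) (h2 : P 2) (h3 : P 3) : ∀ k : Fin 4, P k := by
  intro k
  fin_cases k
  all_goals first | exact h0 | exact h1 | exact h2 | exact h3

/-! ### The counterexample law (ttrl cp-mix, MIXCOMB.md §7) -/

section Cex

/-- Masses of the eight atoms of positive weight, in the order `∅, {0}, {012}, {3}, {013}, {023}, {123}, {0123}` (patterns of membership in `A_0..A_3`):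
`(20, 4, 10, 20, 5, 5, 1, 5)/70`. [counterexample: ttrl cp-mix] -/
def cex4Weight : Fin 8 → ℝ := ![2/7, 2/35, 1/7, 2/7, 1/14, 1/14, 1/70, 1/14]

/-- The four events, as sets of atoms: `A_i` = the atoms whose pattern contains `i`. [counterexample: ttrl cp-mix] -/
def cex4Event : Fin 4 → Set (Fin 8) :=
  ![{c | c = 1 ∨ c = 2 ∨ c = 4 ∨ c = 5 ∨ c = 7}, {c | c = 2 ∨ c = 4 ∨ c = 6 ∨ c = 7}, {c | c = 2 ∨ c = 5 ∨ c = 6 ∨ c = 7},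
    {c | c = 3 ∨ c = 4 ∨ c = 5 ∨ c = 6 ∨ c = 7}]

/-- Indicator vector of `A_0`. [this work] -/
theorem ind_cex4_zero : ind (cex4Event 0) = ![0, 1, 1, 0, 1, 1, 0, 1] := by
  funext c; fin_cases c <;> simp [cex4Event, ind_of_mem, ind_of_not_mem]

/-- Indicator vector of `A_1`. [this work] -/
theorem ind_cex4_one : ind (cex4Event 1) = ![0, 0, 1, 0, 1, 0, 1, 1] := by
  funext c; fin_cases c <;> simp [cex4Event, ind_of_mem, ind_of_not_mem]

/-- Indicator vector of `A_2`. [this work] -/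
theorem ind_cex4_two : ind (cex4Event 2) = ![0, 0, 1, 0, 0, 1, 1, 1] := by
  funext c; fin_cases c <;> simp [cex4Event, ind_of_mem, ind_of_not_mem]

/-- Indicator vector of `A_3`. [this work] -/
theorem ind_cex4_three : ind (cex4Event 3) = ![0, 0, 0, 1, 1, 1, 1, 1] := by
  funext c; fin_cases c <;> simp [cex4Event, ind_of_mem, ind_of_not_mem]

/-- The counterexample weight is nonnegative. [this work] -/
theorem cex4Weight_nonneg (c : Fin 8) : 0 ≤ cex4Weight c := by
  fin_cases c <;> norm_num [cex4Weight]

/-- The counterexample weight has total mass `1`. [this work] -/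
theorem sum_cex4Weight : ∑ c, cex4Weight c = 1 := by
  simp [cex4Weight, Fin.sum_univ_succ]; norm_num

/-- The fifteen moments `M_R = μ(⋂_{i∈R} A_i)`: `29/70, 3/10, 3/10, 18/35; 2/7, 2/7, 3/14, 8/35, 11/70, 11/70; 3/14, 1/7, 1/7, 3/35; 1/14`. [this work] -/
theorem cex4_moments :
    ex cex4Weight (ind (cex4Event 0)) = 29/70 ∧ ex cex4Weight (ind (cex4Event 1)) = 3/10 ∧ ex cex4Weight (ind (cex4Event 2)) = 3/10 ∧
    ex cex4Weight (ind (cex4Event 3)) = 18/35 ∧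
    ex cex4Weight (ind (cex4Event 0) * ind (cex4Event 1)) = 2/7 ∧ ex cex4Weight (ind (cex4Event 0) * ind (cex4Event 2)) = 2/7 ∧
    ex cex4Weight (ind (cex4Event 0) * ind (cex4Event 3)) = 3/14 ∧ ex cex4Weight (ind (cex4Event 1) * ind (cex4Event 2)) = 8/35 ∧
    ex cex4Weight (ind (cex4Event 1) * ind (cex4Event 3)) = 11/70 ∧ ex cex4Weight (ind (cex4Event 2) * ind (cex4Event 3)) = 11/70 ∧
    ex cex4Weight (ind (cex4Event 1) * ind (cex4Event 2) * ind (cex4Event 3)) = 3/35 ∧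
    ex cex4Weight (ind (cex4Event 0) * ind (cex4Event 2) * ind (cex4Event 3)) = 1/7 ∧
    ex cex4Weight (ind (cex4Event 0) * ind (cex4Event 1) * ind (cex4Event 3)) = 1/7 ∧
    ex cex4Weight (ind (cex4Event 0) * ind (cex4Event 1) * ind (cex4Event 2)) = 3/14 ∧
    ex cex4Weight (ind (cex4Event 0) * ind (cex4Event 1) * ind (cex4Event 2) * ind (cex4Event 3)) = 1/14 := by
  simp only [ex_def, ind_cex4_zero, ind_cex4_one, ind_cex4_two, ind_cex4_three, cex4Weight, Fin.sum_univ_succ, Fin.sum_univ_zero, Pi.mul_apply]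
  simp; norm_num

/-- **The counterexample family is Sahi-nonnegative at EVERY order** (all eleven square-free rows are strictly positive). [this work; law: ttrl cp-mix] -/
theorem allOrders_cex4 : AllOrders cex4Weight cex4Event := by
  obtain ⟨m0, m1, m2, m3, m01, m02, m03, m12, m13, m23, m123, m023, m013, m012, m0123⟩ := cex4_moments
  refine allOrders_four_of_rows cex4Weight_nonneg sum_cex4Weight cex4Event (forall_lt_four ?_ ?_ ?_ ?_ ?_ ?_) (forall_four ?_ ?_ ?_ ?_) ?_
  · rw [m0, m1, m01]; norm_num
  · rw [m0, m2, m02]; norm_num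
  · rw [m0, m3, m03]; norm_num
  · rw [m1, m2, m12]; norm_num
  · rw [m1, m3, m13]; norm_num
  · rw [m2, m3, m23]; norm_num
  · have e : (fun j : Fin 3 => ind (cex4Event ((0 : Fin 4).succAbove j))) = ![ind (cex4Event 1), ind (cex4Event 2), ind (cex4Event 3)] :=
      funext fun j => by fin_cases j <;> rfl
    rw [e, sahiE_three, m1, m2, m3, m12, m13, m23, m123]; norm_num
  · have e : (fun j : Fin 3 => ind (cex4Event ((1 : Fin 4).succAbove j))) = ![ind (cex4Event 0), ind (cex4Event 2), ind (cex4Event 3)] :=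
      funext fun j => by fin_cases j <;> rfl
    rw [e, sahiE_three, m0, m2, m3, m02, m03, m23, m023]; norm_num
  · have e : (fun j : Fin 3 => ind (cex4Event ((2 : Fin 4).succAbove j))) = ![ind (cex4Event 0), ind (cex4Event 1), ind (cex4Event 3)] :=
      funext fun j => by fin_cases j <;> rfl
    rw [e, sahiE_three, m0, m1, m3, m01, m03, m13, m013]; norm_num
  · have e : (fun j : Fin 3 => ind (cex4Event ((3 : Fin 4).succAbove j))) = ![ind (cex4Event 0), ind (cex4Event 1), ind (cex4Event 2)] :=
      funext fun j => by fin_cases j <;> rfl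
    rw [e, sahiE_three, m0, m1, m2, m01, m02, m12, m012]; norm_num
  · have e : (fun j : Fin 4 => ind (cex4Event j)) = ![ind (cex4Event 0), ind (cex4Event 1), ind (cex4Event 2), ind (cex4Event 3)] :=
      funext fun j => by fin_cases j <;> rfl
    rw [e, sahiE_four, m0, m1, m2, m3, m01, m02, m03, m12, m13, m23, m123, m023, m013, m012, m0123]; norm_num

/-! ### OR-ing a fair coin into the members `0, 1` makes `E_4` negative -/

/-- Fourth coin moment of OR-mixture indicators. [this work] -/
theorem exc_or₄ {α : Type*} [Fintype α] (μ : α → ℝ) (h : ℝ) (X Y Z W : Set α) (b b' b'' b''' : Bool) :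
    ex (coinWeight μ h) (ind (orCoin X b) * ind (orCoin Y b') * ind (orCoin Z b'') * ind (orCoin W b''')) =
      (1 - h) * ex μ (ind X * ind Y * ind Z * ind W)
        + h * ex μ ((bif b then 1 else ind X) * (bif b' then 1 else ind Y) * (bif b'' then 1 else ind Z) * (bif b''' then 1 else ind W)) := by
  rw [ex_coinWeight]
  congr 2 <;> (congr 1; funext a; cases b <;> cases b' <;> cases b'' <;> cases b''' <;> simp)

/-- **`E_4(A_0 ∪ H, A_1 ∪ H, A_2, A_3) = −10301/6860000` for an independent fair coin `H`.** [this work; counterexample: ttrl cp-mix] -/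
theorem sahiE_four_orCoin_cex4 :
    sahiE (coinWeight cex4Weight (1/2 : ℝ)) 4
      ![ind (orCoin (cex4Event 0) true), ind (orCoin (cex4Event 1) true), ind (orCoin (cex4Event 2) false), ind (orCoin (cex4Event 3) false)]
      = -10301/6860000 := by
  obtain ⟨m0, m1, m2, m3, m01, m02, m03, m12, m13, m23, m123, m023, m013, m012, m0123⟩ := cex4_moments
  rw [sahiE_four]
  simp only [exc_or₄, exc_or₃, exc_or₂, exc_or₁ cex4Weight (1/2 : ℝ) sum_cex4Weight, cond_true, cond_false, one_mul, mul_one,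
    ex_one sum_cex4Weight]
  rw [m0, m1, m2, m3, m01, m02, m03, m12, m13, m23, m123, m023, m013, m012, m0123]
  norm_num

/-- **THE MIXTURE CONJECTURE `MixtureBernsteinPositivity` IS FALSE** (its OR half, four events, mixing into two of the four members). [this work;
counterexample: ttrl cp-mix] -/
theorem not_mixtureBernsteinPositivity : ¬ MixtureBernsteinPositivity := by
  intro hmix
  have h := (hmix (Fin 8) cex4Weight cex4Weight_nonneg sum_cex4Weight 4 cex4Event ![true, true, false, false] allOrders_cex4 4 id).1
  have hnn := h.nonneg (h := (1/2 : ℝ)) (by norm_num) (by norm_num)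
  have e : (fun j : Fin 4 => ind (orCoin (cex4Event (id j)) ((![true, true, false, false] : Fin 4 → Bool) (id j))))
      = ![ind (orCoin (cex4Event 0) true), ind (orCoin (cex4Event 1) true), ind (orCoin (cex4Event 2) false), ind (orCoin (cex4Event 3) false)] :=
    funext fun j => by fin_cases j <;> rfl
  rw [e, sahiE_four_orCoin_cex4] at hnn
  norm_num at hnn

end Cex

/-! ### What survives: the AND-mixture conjecture -/

/-- **THE AND-MIXTURE CONJECTURE** (the surviving half of `MixtureBernsteinPositivity`; this seat gen 5, HIERARCHY.md §12): for every probability weight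
on a finite type, every family `A` Sahi-nonnegative at every order, every `F` and every multiset `s`, `h ↦ E_m(μ ⊗ coin(h); (1_{A_{s j} ∩ ([F(s j)] → coin)})_j)`
is Bernstein-positive of degree `m`.  THEOREM for `n ≤ 3` (`andMixture_three`); for `n = 4` ttrl cp-mix holds exact degree-5 certificates of all nine open
square-free cell coefficients (MIXCOMB.md §8; Lean replay pending); OPEN in general.  An obligation of our theories, never a fact: use as
`(h : AndMixtureBernsteinPositivity)`. [status: open] -/
@[conjecture] def AndMixtureBernsteinPositivity : Prop :=
  ∀ (α : Type) [Fintype α] (μ : α → ℝ), (∀ a, 0 ≤ μ a) → ∑ a, μ a = 1 →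
    ∀ (n : ℕ) (A : Fin n → Set α) (F : Fin n → Bool), AllOrders μ A →
      ∀ (m : ℕ) (s : Fin m → Fin n), BernsteinPos m (fun h => sahiE (coinWeight μ h) m (fun j => ind (andCoin (A (s j)) (F (s j)))))

/-- `AndMixtureBernsteinPositivity` restricted to three events is a theorem. [this work] -/
theorem andMixture_three :
    ∀ (α : Type) [Fintype α] (μ : α → ℝ), (∀ a, 0 ≤ μ a) → ∑ a, μ a = 1 →
      ∀ (A : Fin 3 → Set α) (F : Fin 3 → Bool), AllOrders μ A →
        ∀ (m : ℕ) (s : Fin m → Fin 3), BernsteinPos m (fun h => sahiE (coinWeight μ h) m (fun j => ind (andCoin (A (s j)) (F (s j))))) :=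
  fun _ _ _ hμ hμ1 A F hA m s => (mixture_three hμ hμ1 A hA F m s).2

end SahiMixture

end Summit.CriticalPhenomena.PercolationContinuityZ3.Theorems

end
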